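import Literature.AlgebraicTopology.SingularHomology.SubsetCochainsPullback
import Literature.AlgebraicTopology.SingularHomology.SubsetCochainsComparisonPull
import Literature.AlgebraicTopology.SingularHomology.SubsetCohomologyMayerVietoris
import Literature.AlgebraicTopology.SingularHomology.CohomologyMayerVietorisInjective
import HarnessLib

/-!
# A Mayer–Vietoris four-lemma: injectivity of a pull-back from an open cover

For a continuous map `g : Y → X`, an open cover `X = A ∪ B` and its preimage cover
`Y = g⁻¹A ∪ g⁻¹B`, the pull-backs `g*` form a ladder between the two Mayer–Vietoris sequences
(naturality of `δ`: the tree's `subsetCochains.mvδ_pull`). A diagram chase: if `H^{p+1}_X(B) = 0`,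
`H^p_Y(g⁻¹B) = 0`, `g* : H^p_X(A) → H^p_Y(g⁻¹A)` is onto, `g*` is one-to-one on `H^p_X(A ∩ B)`
and on `H^{p+1}_X(A)`, then `g* : H^{p+1}_X(A ∪ B) → H^{p+1}_Y(g⁻¹A ∪ g⁻¹B)` is one-to-one.
Everything in the tree's model of the cohomology of subsets computed in the ambient cochains
(`subsetCochains`); a corollary restates the conclusion for `singularCohomology` of the spaces.
-/

noncomputable section

open CategoryTheory Limits

universe u v

namespace Literature.AlgebraicTopology.SingularHomology

namespace subsetCochains

variable {R : Type v} [CommRing R] {N : ModuleCat.{max u v} R} {X Y : Type u}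
  [TopologicalSpace X] [TopologicalSpace Y] (g : C(Y, X)) {A B : Set X}

/-- **Mayer–Vietoris four-lemma for pull-backs.** Let `g : Y → X` be continuous, `A`, `B ⊆ X`
open. If `H^{p+1}_X(B) = 0` and `H^p_Y(g⁻¹B) = 0`, `g* : H^p_X(A) → H^p_Y(g⁻¹A)` is surjective,
and `g*` is injective on `H^p_X(A ∩ B)` and on `H^{p+1}_X(A)`, then
`g* : H^{p+1}_X(A ∪ B) → H^{p+1}_Y(g⁻¹A ∪ g⁻¹B)` is injective (chase on the ladder of
Mayer–Vietoris sequences, `mvδ_pull`). [cite: HatcherAT2002, §3.1 p. 204 and §2.2 p. 150] -/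
theorem pullH_union_injective (hA : IsOpen A) (hB : IsOpen B) {p : ℕ}
    (hBz : Limits.IsZero ((subsetCochains R N B).homology (p + 1)))
    (hB'z : Limits.IsZero ((subsetCochains R N (g ⁻¹' B)).homology p))
    (hAs : Function.Surjective (pullH (N := N) g (mapsTo_preimage_left g A) p))
    (hABi : Function.Injective (pullH (N := N) g (mapsTo_preimage_inter g A B) p))
    (hAi : Function.Injective (pullH (N := N) g (mapsTo_preimage_left g A) (p + 1))) :
    Function.Injective (pullH (N := N) g (mapsTo_preimage_union g A B) (p + 1)) := by
  have hA' : IsOpen (g ⁻¹' A) := hA.preimage g.continuous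
  have hB' : IsOpen (g ⁻¹' B) := hB.preimage g.continuous
  refine (injective_iff_map_eq_zero _).2 fun z hz ↦ ?_
  -- `z|_A = 0`: its pull-back is `(g* z)|_{g⁻¹A} = 0`
  have hzA : resH Set.subset_union_left (p + 1) z = 0 := by
    apply hAi
    have h := ConcreteCategory.congr_hom (resH_comp_pullH (N := N) g
      (Set.subset_union_left : g ⁻¹' A ⊆ g ⁻¹' A ∪ g ⁻¹' B) (Set.subset_union_left : A ⊆ A ∪ B)
      (mapsTo_preimage_union g A B) (mapsTo_preimage_left g A) (p + 1)) z
    rw [ModuleCat.comp_apply, ModuleCat.comp_apply] at h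
    rw [h, hz, map_zero, map_zero]
  -- `z|_B = 0` since `H^{p+1}_X(B) = 0`
  have hzB : resH Set.subset_union_right (p + 1) z = 0 :=
    @Subsingleton.elim _ (ModuleCat.subsingleton_of_isZero hBz) _ _
  -- so `z = δ e`
  obtain ⟨e, rfl⟩ := exists_of_res_eq_zero hA hB z hzA hzB
  -- `δ (g* e) = g* (δ e) = 0`
  have hδ : mvδ R N hA' hB' p (pullH (N := N) g (mapsTo_preimage_inter g A B) p e) = 0 := by
    have h := ConcreteCategory.congr_hom (mvδ_pull (N := N) g A B hA hB p) e
    rw [ModuleCat.comp_apply, ModuleCat.comp_apply] at h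
    rw [← h, hz]
  -- hence `g* e = a'| - b'|` with `b' ∈ H^p_Y(g⁻¹B) = 0`, and `a' = g* a`
  obtain ⟨a', b', hab⟩ := exists_of_mvδ_eq_zero hA' hB' _ hδ
  have hb' : b' = 0 := @Subsingleton.elim _ (ModuleCat.subsingleton_of_isZero hB'z) _ _
  rw [hb', map_zero, sub_zero] at hab
  obtain ⟨a, rfl⟩ := hAs a'
  -- `g* (e - a|) = 0`, so `e = a|`, and `δ (a|) = 0`
  have he : e = resH Set.inter_subset_left p a := by
    apply hABi
    rw [hab]
    have h := ConcreteCategory.congr_hom (resH_comp_pullH (N := N) g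
      (Set.inter_subset_left : g ⁻¹' A ∩ g ⁻¹' B ⊆ g ⁻¹' A) (Set.inter_subset_left : A ∩ B ⊆ A)
      (mapsTo_preimage_left g A) (mapsTo_preimage_inter g A B) p) a
    rw [ModuleCat.comp_apply, ModuleCat.comp_apply] at h
    exact h.symm
  rw [he, mvδ_res_left]


/-! ### The same for the singular cohomology of the subspaces -/

section Singular

-- as in `SubsetCochainsComparisonPull`: chains of the concrete complex are `Finsupp`s up to
-- unfolding of semireducible definitions
set_option backward.isDefEq.respectTransparency false

variable {U : Set Y} {V : Set X} (h : Set.MapsTo g U V)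

/-- `g* : H^n_X(V) → H^n_Y(U)` is injective iff `(g|)* : Hⁿ(↥V) → Hⁿ(↥U)` is. [folklore] -/
theorem pullH_injective_iff (n : ℕ) :
    Function.Injective (pullH (N := SimplexSpan.coefR R) g h n) ↔
      Function.Injective (singularCohomology.map R R (restrictMap g h) n) := by
  have hsq : (fun y ↦ (homologyIsoSingularCohomology R U n).hom (pullH (N := SimplexSpan.coefR R) g h n y)) =
      fun y ↦ singularCohomology.map R R (restrictMap g h) n ((homologyIsoSingularCohomology R V n).hom y) :=
    funext (homologyIsoSingularCohomology_hom_pullH g h n)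
  have eU := (ConcreteCategory.isIso_iff_bijective (homologyIsoSingularCohomology R U n).hom).1 inferInstance
  have eV := (ConcreteCategory.isIso_iff_bijective (homologyIsoSingularCohomology R V n).hom).1 inferInstance
  constructor
  · intro hb
    have h2 : Function.Injective ((singularCohomology.map R R (restrictMap g h) n) ∘
        (homologyIsoSingularCohomology R V n).hom) := by
      change Function.Injective (fun y ↦ singularCohomology.map R R (restrictMap g h) n
        ((homologyIsoSingularCohomology R V n).hom y))
      rw [← hsq]; exact eU.1.comp hb
    exact (Function.Injective.of_comp_iff' _ eV).1 h2
  · intro hb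
    have h2 : Function.Injective ((homologyIsoSingularCohomology R U n).hom ∘
        (pullH (N := SimplexSpan.coefR R) g h n)) := by
      change Function.Injective (fun y ↦ (homologyIsoSingularCohomology R U n).hom
        (pullH (N := SimplexSpan.coefR R) g h n y))
      rw [hsq]; exact hb.comp eV.1
    exact (Function.Injective.of_comp_iff eU.1 _).1 h2

/-- `g* : H^n_X(V) → H^n_Y(U)` is surjective iff `(g|)* : Hⁿ(↥V) → Hⁿ(↥U)` is. [folklore] -/
theorem pullH_surjective_iff (n : ℕ) :
    Function.Surjective (pullH (N := SimplexSpan.coefR R) g h n) ↔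
      Function.Surjective (singularCohomology.map R R (restrictMap g h) n) := by
  have hsq : (fun y ↦ (homologyIsoSingularCohomology R U n).hom (pullH (N := SimplexSpan.coefR R) g h n y)) =
      fun y ↦ singularCohomology.map R R (restrictMap g h) n ((homologyIsoSingularCohomology R V n).hom y) :=
    funext (homologyIsoSingularCohomology_hom_pullH g h n)
  have eU := (ConcreteCategory.isIso_iff_bijective (homologyIsoSingularCohomology R U n).hom).1 inferInstance
  have eV := (ConcreteCategory.isIso_iff_bijective (homologyIsoSingularCohomology R V n).hom).1 inferInstance
  constructor
  · intro hb
    have h2 : Function.Surjective ((singularCohomology.map R R (restrictMap g h) n) ∘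
        (homologyIsoSingularCohomology R V n).hom) := by
      change Function.Surjective (fun y ↦ singularCohomology.map R R (restrictMap g h) n
        ((homologyIsoSingularCohomology R V n).hom y))
      rw [← hsq]; exact eU.2.comp hb
    exact (Function.Surjective.of_comp_iff _ eV.2).1 h2
  · intro hb
    have h2 : Function.Surjective ((homologyIsoSingularCohomology R U n).hom ∘
        (pullH (N := SimplexSpan.coefR R) g h n)) := by
      change Function.Surjective (fun y ↦ (homologyIsoSingularCohomology R U n).hom
        (pullH (N := SimplexSpan.coefR R) g h n y))
      rw [hsq]; exact hb.comp eV.2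
    exact (Function.Surjective.of_comp_iff' eU _).1 h2

/-- `H^n_X(W) = 0` iff `Hⁿ(↥W) = 0`. [folklore] -/
theorem isZero_homology_of_isZero_singularCohomology {Z : Type u} [TopologicalSpace Z] (W : Set Z)
    (n : ℕ) (hW : Limits.IsZero (singularCohomology R R (↥W) n)) :
    Limits.IsZero ((subsetCochains R (SimplexSpan.coefR R) W).homology n) :=
  Limits.IsZero.of_iso hW (homologyIsoSingularCohomology R W n)

/-- **Mayer–Vietoris four-lemma for pull-backs, for the singular cohomology of the spaces.** Let
`g : Y → X` be continuous and `X = A ∪ B` an open cover with `H^{p+1}(↥B) = 0`,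
`Hᵖ(↥(g⁻¹B)) = 0`, `(g|)* : Hᵖ(↥A) → Hᵖ(↥(g⁻¹A))` surjective, and `(g|)*` injective on
`Hᵖ(↥(A ∩ B))` and on `H^{p+1}(↥A)`. Then `g* : H^{p+1}(X) → H^{p+1}(Y)` is injective.
[cite: HatcherAT2002, §3.1 p. 204 and §2.2 p. 150] -/
theorem singularCohomology_map_injective_of_cover (hA : IsOpen A) (hB : IsOpen B)
    (hAB : A ∪ B = Set.univ) {p : ℕ}
    (hBz : Limits.IsZero (singularCohomology R R (↥B) (p + 1)))
    (hB'z : Limits.IsZero (singularCohomology R R (↥(g ⁻¹' B)) p))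
    (hAs : Function.Surjective
      (singularCohomology.map R R (restrictMap g (mapsTo_preimage_left g A)) p))
    (hABi : Function.Injective
      (singularCohomology.map R R (restrictMap g (mapsTo_preimage_inter g A B)) p))
    (hAi : Function.Injective
      (singularCohomology.map R R (restrictMap g (mapsTo_preimage_left g A)) (p + 1))) :
    Function.Injective (singularCohomology.map R R g (p + 1)) := by
  -- the four-lemma in the model, read on the subspaces `↥(A ∪ B)`, `↥(g⁻¹A ∪ g⁻¹B)`
  have key : Function.Injective
      (singularCohomology.map R R (restrictMap g (mapsTo_preimage_union g A B)) (p + 1)) :=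
    (pullH_injective_iff g _ (p + 1)).1
      (pullH_union_injective g hA hB (isZero_homology_of_isZero_singularCohomology B _ hBz)
        (isZero_homology_of_isZero_singularCohomology _ _ hB'z)
        ((pullH_surjective_iff g _ p).2 hAs) ((pullH_injective_iff g _ p).2 hABi)
        ((pullH_injective_iff g _ (p + 1)).2 hAi))
  -- transport along the homeomorphism `↥(A ∪ B) ≃ X`
  let e : ↥(A ∪ B) ≃ₜ X := (Homeomorph.setCongr hAB).trans (Homeomorph.Set.univ X)
  have he : (e : C(↥(A ∪ B), X)) = valMap (A ∪ B) := by ext x; rfl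
  refine (injective_iff_map_eq_zero _).2 fun c hc ↦ ?_
  have h1 : singularCohomology.map R R (restrictMap g (mapsTo_preimage_union g A B)) (p + 1)
      (singularCohomology.map R R (valMap (A ∪ B)) (p + 1) c) = 0 := by
    rw [← ModuleCat.comp_apply, ← singularCohomology.map_comp, valMap_comp_restrictMap,
      singularCohomology.map_comp, ModuleCat.comp_apply, hc, map_zero]
  have h2 : singularCohomology.map R R (valMap (A ∪ B)) (p + 1) c = 0 :=
    (injective_iff_map_eq_zero _).1 key _ h1
  have hinj : Function.Injective (singularCohomology.map R R (e : C(↥(A ∪ B), X)) (p + 1)) :=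
    ((forget (ModuleCat R)).mapIso (singularCohomology.mapIso R R e (p + 1))).toEquiv.injective
  apply hinj
  rw [map_zero, he, h2]

end Singular

end subsetCochains

end Literature.AlgebraicTopology.SingularHomology

end
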